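import Literature.MathematicalPhysics.QuantumFieldTheory.Balaban1983to89.B9Eq315QTowerLipschitzL2
import Literature.MathematicalPhysics.QuantumFieldTheory.Balaban1983to89.B9Eq315QTowerFlatNorm
import Literature.MathematicalPhysics.QuantumFieldTheory.Balaban1983to89.B9Eq324PenaltyPointwiseBound

/-!
# `Balaban1983to89.B9Eq316PenaltyPointwiseBound` — T. Bałaban, *Propagators for lattice gauge theories in a background field*, Commun. Math. Phys.
# **99** (1985) 389–434 [Balaban1985BackgroundPropagators] (3.15)–(3.16) p. 393 with (3.26) p. 395, (3.11) p. 392, Thm 3.3 p. 399 ((3.42)∕(3.47) pp. 397–398)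
# and [Balaban1985Averaging] (124)–(127) pp. 36–37, p. 24: **THE VECTOR-FIELD AVERAGING PENALTY `Q(U)†(a•Q(U))` OF `Δ_a(U) = Δ(U) + D_UR(U)D*_U + Q*(U)aQ(U)`
# IS BOUNDED `L² → L^∞` AT EVERY BACKGROUND OF THE CHAIN's CLASS — `‖((Q(U)†(a•Q(U)))v)(b)‖ ≤ |a|·(M_φ′M_φ(1 + 50(d+1)α))²·(2d·c₁∕c₀)∕√c₀·‖v‖_{L²(c₀)}`
# at every fine bond (one step, `B9Eq315QTorus.QtorusW`), with the `L²` letter `‖Q(U)f‖ ≤ M_φ′M_φ(1 + 50(d+1)α)√(2d·c₁∕c₀)·‖f‖` (`hQ`) and the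
# pointwise adjoint on the way; the sharper constants on the bond window `‖U(b) − 1‖ ≤ ε_U`, and the tower `Q_k(U)` (`B9Eq326OperatorTower.QkW`) on the
# per-level windows** — the BOND twin of ne9-leaf-03's site file `B9Eq324PenaltyPointwiseBound` ((P) for `a′Q′(U)†Q′(U)`): the binder `hP₂` of the
# pub-balaban NE9 owner's value row of the LOCAL PART `A₀` of (3.26) (`B9Eq326LocalPartSupBound.norm_localInv_apply_le`, stone (I0) of plan v11,
# `t4/b2b-balaban-t4-ne9-p1/g92/PLAN-V11-D0-LEDGER.md` §2 «(I0)'s (P₂) … and (FS)»; `g93/PLAN-V11-LETTERS-LEDGER.md` §2) INHABITED at the chain's averaging,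
# and the displayed letter `hQ : ‖Q(U)f‖ ≤ C_Q‖f‖` of the `H₁`-row socket census (ne9-leaf-06 g81, journal l.62111; t4-ne9-idea-1 g149 L-g149-6 (iii)) SUPPLIED

statement-level skeleton of published theorems with citation tags; proofs where landed; nothing here is a claim about the Yang–Mills mass gap

CITATION HEADER (lean-in-tree rule).  Audit cell `pub-balaban`, sub-cell `t4`, BINDER row NE9; filed by NE9 formalisation-swarm LEAF PROVER 01
(`b2b-balaban-t4-ne9-formalise-leaf-01`, gen 87), INTENT I-ne9leaf01-g87-1, composing BY NAME: `B9Eq311L2Pairing.WL2` ((3.11): `equiv`, `norm_sq`),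
`B9Eq315QTorus.QtorusLin` ∕ `QtorusW` ((3.15), one step), `B9Eq326OperatorTower.QkW` (the tower), [B7] (126) `B7Prop3GeneralLinearBound.norm_linQcov_le` with
the locality (122) `B7Prop5GeneralLevels.linQcov_congr`, ne9-leaf-02's box clamp ∕ overlap count ∕ `δ_Q`-letters `B9Eq315QLipschitzL2.exists_truncation` ∕
`sum_local_mass_le` ∕ `norm_QtorusW_sub_flat_le_local` and `B9Eq315QTowerLipschitzL2.norm_QkW_sub_flat_le_L2`, ne9-leaf-03's flat counts
`B9Eq315QFlatNorm.norm_QtorusW_one_le` ∕ `B9Eq315QTowerFlatNorm.norm_QkW_one_le` and duality `B9Eq324PenaltyPointwiseBound.norm_adjoint_apply_le`, the flat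
letters `B7Eq122LinearPartIsLinear.one_mem_U1` ∕ `flat_regular`, `B9Eq315QTowerFlat.perCfg_UlevOf_one_mem_U1` ∕ `norm_Wcx_UlevOf_one_sub_one_le`, Mathlib's
`LinearMap.adjoint`.  Sources READ by this seat in the held text layer `paper:balaban1985-cmp99-background-propagators` (journal page = PDF page + 388):
p. 393 *«They are compositions of j one-step averaging operators Q_j(U) = Q(Ū^{j−1})…Q(U), (3.15) where Q(V) is given by the explicit formula (124) in [5].»*
and *«We define an operator Q*aQ by the quadratic form ⟨A, Q*aQA⟩ = Σ_{j=0}^{k} a Σ_{b∈Λ_j} (L^jη)^{d−2}|(Q_j(U)A)(b)|². (3.16)»*; p. 395 *«We define Δ_a(U) =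
Δ(U) + D_UR(U)D*_U + Q*(U)aQ(U), (3.26) or simply Δ_a = Δ + DRD* + Q*aQ.»*; p. 398 *«and the global inequalities |G′(U)λ|_{(2+γ)}, |∇_UG′(U)λ|_{(1+γ)}, …
(3.47)»*; p. 399 Thm 3.3 *«Under the assumptions of Theorem 3.1, and with the constants described there, the operator G(U) (a = 1) satisfies the
inequalities (3.42)–(3.47), with G′(U) replaced by G(U) and λ replaced by a function J defined at bonds of the lattice T_η or Ω₀, and with values in 𝔤.»*;
[B7] (126) through the tree's verbatim quotation in `B7Prop3GeneralLinearBound`.  NOTHING of print's random-walk proof (pp. 415–426) is reproduced.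

WHY THIS FILE (cell context).  The owner's value row of the local part `A₀ = Δ(U) + D_UD*_U + Q†(a•Q)` (stone (I0)) displays six letters; (P₂)
`‖(Q†(a•Q)v)(b)‖ ≤ p₂‖v‖` was typed for SITES only (ne9-leaf-03: the site averaging `Q′(U)` of (3.19), whose adjoint is a uniform SPREAD).  For the BOND
averaging `Q(U)` of (3.15) the tree holds no kernel (`linQcov` is the `t`-derivative of [B7] (121)'s non-linear average) — only the sup letter (126) and the
flat mean (125); so the one-bond image is read through DUALITY from an `L²` bound: `‖Q(δ_b u)‖ ≤ C_Q√c₀‖u‖` ⟹ `‖(Q†h)(b)‖ ≤ (C_Q∕√c₀)‖h‖`, `p₂ = |a|·C_Q²∕√c₀`.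
The `L²` letter `C_Q` — «the only displayed letter WITHOUT a located one-line supplier is `hQ : ‖Q(U)f‖ ≤ C_Q‖f‖`» (ne9-leaf-06 g81's socket census of the
`H₁` row) — is typed here at EVERY background of the class (local sup letter squared and summed with the overlap count `2d`; no window) and, sharper, on the
bond window (flat mean + `δ_Q`), one step and tower.

WHAT IS PROVED (sorry-free; proof lane — no `def`, no `Prop` placeholder; [folklore] bookkeeping BY NAME; nothing of [B9] asserted).
* §0 (any weighted carrier `WL2 𝕜 w V`, finite-dimensional target) `norm_single_eq` (`‖δ_x u‖ = √w(x)·‖u‖`), **`norm_adjoint_apply_le_of_norm_le`**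
  (`‖Af‖ ≤ C‖f‖` ⟹ `‖(A†h)(x)‖ ≤ (C∕√w(x))‖h‖`), **`norm_adjoint_smul_apply_le_of_norm_le`** (⟹ `‖(A†(a•A)v)(x)‖ ≤ ‖a‖C²∕√w(x)·‖v‖` — the `hP₂` SHAPE).
* §1 ONE STEP, every background with the displayed regularity letters (`hα1 hU1 hreg`), NO window: **`norm_QtorusLin_apply_le_local`** (`‖(Q(U)A)(c)‖ ≤
  (1 + 50(d+1)α)·√S_c(A)`, `S_c` the `ℓ²` mass over `B(c₋) ∪ B(c₊)`), `opConst_nonneg`, **`norm_QtorusW_le`** (`hQ`: `C_Q = M_φ′M_φ(1 + 50(d+1)α)√(2d·c₁∕c₀)`).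
* §2 **`norm_adjoint_QtorusW_apply_le`** (`‖(Q(U)†h)(b)‖ ≤ (C_Q∕√c₀)‖h‖`), **`norm_penalty_QtorusW_apply_le`** — THE LETTER (P₂), literally the binder `hP₂` of
  `norm_localInv_apply_le` at `Q := QtorusW …`, `p₂ := |a|·(M_φ′M_φ(1 + 50(d+1)α))²·(2d·c₁∕c₀)∕√c₀`; **`…_diagonal`** (`c₁ = L^d c₀`: `p₂ = |a|·(…)²·2d·L^d∕√c₀`).
* §3 ON THE BOND WINDOW: **`norm_QtorusW_le_of_window`** (`C_Q = M_φ′M_φ(√(c₁∕(c₀L^d)) + √(2d·c₁∕c₀)·102(d+1)²L·ε_U)`, the flat letters discharged at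
  `α′ = 0`), **`norm_penalty_QtorusW_apply_le_of_window`** (`p₂ = |a|·C_Q²∕√c₀`; at `ε_U = 0` on the diagonal `|a|(M_φ′M_φ)²∕√c₀`).
* §4 THE TOWER `Q_k(U)`, `k = n+1`, on the per-level windows `ε_j`: **`norm_QkW_le_of_window`** (`C_k = M_φ′M_φ√(c₁∕(c₀(L^k)^d))·Π_{j<k}(1 + √(L^d)√(2d)·102(d+1)²L·ε_j)`),
  **`norm_penalty_QkW_apply_le_of_window`** (`p₂ = |a|·C_k²∕√c₀`).
MODEL ∕ DECLARED READINGS.  (M1) periodic lattices `TSite d (L·m)` ∕ `towerP L m k` over `TSite d m`, fibre `W ≃ 𝔸` along `φ` (`M_φ`, `M_φ′`), weights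
`c₀` (fine), `c₁` (coarse bonds), free positive reals ((3.16)'s `(L^jη)^{d−2}` is the consumer's `c₁`); (M2) the background enters ONLY through the averaging's
displayed regularity letters — NO small-field window in §§1–2; §§3–4 add the bond windows; (M3) the constants are NOT Jensen-sharp: §1's `√(2d·c₁∕c₀)` (vs
the flat `√(c₁∕(c₀L^d))`) is the price of reading (126)'s SUP letter in `ℓ²` without a kernel, §2's `1∕√c₀` is duality's one-bond weight — on the one-step
diagonal (`c₀ = η^d`, `ηL = 1`) every constant is a function of `d, L, M_φM_φ′, α` (resp. `ε_U`) alone, NO volume; in (I0)'s row `p₂` enters as `(2p₂ + C₃)C_E√μ`.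
HONEST SCOPE.  ONE displayed letter ((P₂) at the bond averaging) of the owner's substitute route for the value row of the LOCAL part inhabited, plus `hQ`;
NOT Thm 3.1 ∕ 3.3, no decay, no ∇-row, no random walk; NOT NE9 (cell pub-balaban: NE9 NOT PRINTED ∕ NOT PROVED; «NE9 ⇐ the named binders»; row WALLED ON A
MODEL (O-NE9-1; #5 UNRULED); spine PROVED 0∕9; rung (B)+1 on a finite T⁴ — NOT infinite volume, NOT mass gap, NOT BetaPertH, NOT Clay; HONEST DEPENDENCY:
continuum YM on T⁴ ⇐ BetaPertH ∧ nine spine estimates (0/9 proved); BetaPertH ⇐ (D1) ∧ (D4) ∧ CAP+tail; G-an2-4 gates asym, D1 and NE2/3/4).  NEW file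
importing `B9Eq315QTowerLipschitzL2`, `B9Eq315QTowerFlatNorm`, `B9Eq324PenaltyPointwiseBound`; nothing modified.  Net new unproved facts: 0.
-/

noncomputable section

open scoped InnerProductSpace ComplexConjugate BigOperators
namespace Literature.MathematicalPhysics.QuantumFieldTheory.Balaban1983to89.B9Eq316PenaltyPointwiseBound

open B7Prop1Explicit (U1 Wcx boxVec e)
open B7Prop1Local (AgreeOn bondHi)
open B7Prop3GeneralLinear (linQcov)
open B7Prop3GeneralLinearBound (norm_linQcov_le)
open B7Prop5GeneralLevels (linQcov_congr)
open B4Sect5Torus (TSite)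
open B9SectCLatticeCarrier (Bond)
open B9Eq319QprimeTorus (fineP)
open B9Eq311L2Pairing (WL2)
open B11Eq103H1Complex (BondL2K)
open B9Eq315QTorus (perSite perCfg cornerSite QtorusLin QtorusLin_apply QtorusW QtorusW_apply)
open B9Eq315QLipschitzL2 (exists_truncation sum_local_mass_le norm_QtorusW_sub_flat_le_local)
open B9Eq315QFlatNorm (norm_QtorusW_one_le)
open B9Eq324PenaltyPointwiseBound (norm_adjoint_apply_le)
open B7Eq122LinearPartIsLinear (one_mem_U1 flat_regular)
open B9Eq315QTower (towerP UlevOf)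
open B9Eq315QTowerFlat (perCfg_UlevOf_one_mem_U1 norm_Wcx_UlevOf_one_sub_one_le)
open B9Eq326OperatorTower (QkW)
open B9Eq315QTowerLipschitzL2 (norm_QkW_sub_flat_le_L2)
open B9Eq315QTowerFlatNorm (norm_QkW_one_le)

/-! ## §0 Duality on the weighted carrier: pointwise adjoint and penalty sizes from an operator bound -/

section Duality

variable {X : Type*} [Fintype X] [DecidableEq X] {𝕜 : Type*} [RCLike 𝕜] {w : X → ℝ} [Fact (∀ x, 0 < w x)]
  {V : Type*} [NormedAddCommGroup V] [InnerProductSpace 𝕜 V]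

/-- **THE ONE-SITE FUNCTION HAS NORM `√w(x)·‖u‖`** in the weighted `L²` carrier (3.11). [folklore] [cite: Balaban1985BackgroundPropagators, (3.11) p.392] -/
theorem norm_single_eq (x : X) (u : V) : ‖(WL2.equiv 𝕜 w V).symm (Pi.single x u)‖ = Real.sqrt (w x) * ‖u‖ := by
  have hw : 0 < w x := (Fact.out : ∀ x, 0 < w x) x
  have h : ‖(WL2.equiv 𝕜 w V).symm (Pi.single x u)‖ ^ 2 = (Real.sqrt (w x) * ‖u‖) ^ 2 := by
    rw [WL2.norm_sq, Finset.sum_eq_single x, Equiv.apply_symm_apply, Pi.single_eq_same, mul_pow, Real.sq_sqrt hw.le]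
    · intro y _ hy
      rw [Equiv.apply_symm_apply, Pi.single_eq_of_ne hy, norm_zero, zero_pow two_ne_zero, mul_zero]
    · intro h
      exact absurd (Finset.mem_univ x) h
  exact (pow_left_inj₀ (norm_nonneg _) (by positivity) two_ne_zero).1 h

variable [FiniteDimensional 𝕜 V] {H : Type*} [NormedAddCommGroup H] [InnerProductSpace 𝕜 H] [FiniteDimensional 𝕜 H]

/-- **THE POINTWISE SIZE OF AN ADJOINT FROM AN OPERATOR BOUND**: `‖Af‖ ≤ C‖f‖` (`C ≥ 0`) ⟹ `‖(A†h)(x)‖ ≤ (C∕√w(x))·‖h‖` — ne9-leaf-03's duality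
`B9Eq324PenaltyPointwiseBound.norm_adjoint_apply_le` at the one-site image `‖A(δ_x u)‖ ≤ C√w(x)·‖u‖`. [folklore]
[cite: Balaban1985BackgroundPropagators, (3.11) p.392, (3.16) p.393] -/
theorem norm_adjoint_apply_le_of_norm_le (A : WL2 𝕜 w V →ₗ[𝕜] H) {C : ℝ} (hC : 0 ≤ C) (hA : ∀ f, ‖A f‖ ≤ C * ‖f‖) (h : H) (x : X) :
    ‖WL2.equiv 𝕜 w V (LinearMap.adjoint A h) x‖ ≤ C / Real.sqrt (w x) * ‖h‖ := by
  have hw : 0 < w x := (Fact.out : ∀ x, 0 < w x) x; have hs : 0 < Real.sqrt (w x) := Real.sqrt_pos.2 hw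
  have hκ : ∀ u : V, ‖A ((WL2.equiv 𝕜 w V).symm (Pi.single x u))‖ ≤ C * Real.sqrt (w x) * ‖u‖ := fun u =>
    calc ‖A ((WL2.equiv 𝕜 w V).symm (Pi.single x u))‖ ≤ C * ‖(WL2.equiv 𝕜 w V).symm (Pi.single x u)‖ := hA _
      _ = C * Real.sqrt (w x) * ‖u‖ := by rw [norm_single_eq, mul_assoc]
  have h1 := norm_adjoint_apply_le A x (by positivity) hκ h
  have hsc : C * Real.sqrt (w x) / w x = C / Real.sqrt (w x) := by
    rw [div_eq_div_iff hw.ne' hs.ne', mul_assoc, Real.mul_self_sqrt hw.le]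
  rwa [hsc] at h1

/-- **THE PENALTY LETTER FROM AN OPERATOR BOUND**: `‖Af‖ ≤ C‖f‖` ⟹ `‖(A†(a•A)v)(x)‖ ≤ ‖a‖·C²∕√w(x)·‖v‖` — the shape of the sup-norm bootstrap's
binder `hP₂` for ANY averaging `A` with an `L²` bound. [folklore] [cite: Balaban1985BackgroundPropagators, (3.16) p.393, (3.26) p.395, Thm 3.3 (3.47) p.398] -/
theorem norm_adjoint_smul_apply_le_of_norm_le (A : WL2 𝕜 w V →ₗ[𝕜] H) {C : ℝ} (hC : 0 ≤ C) (hA : ∀ f, ‖A f‖ ≤ C * ‖f‖)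
    (a : 𝕜) (v : WL2 𝕜 w V) (x : X) :
    ‖WL2.equiv 𝕜 w V ((LinearMap.adjoint A ∘ₗ (a • A)) v) x‖ ≤ ‖a‖ * C ^ 2 / Real.sqrt (w x) * ‖v‖ := by
  have hw : 0 < w x := (Fact.out : ∀ x, 0 < w x) x
  rw [LinearMap.comp_apply, LinearMap.smul_apply]
  have h1 := norm_adjoint_apply_le_of_norm_le A hC hA (a • A v) x
  have h2 : ‖a • A v‖ ≤ ‖a‖ * (C * ‖v‖) := by
    rw [norm_smul]
    exact mul_le_mul_of_nonneg_left (hA v) (norm_nonneg a)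
  calc ‖WL2.equiv 𝕜 w V (LinearMap.adjoint A (a • A v)) x‖ ≤ C / Real.sqrt (w x) * ‖a • A v‖ := h1
    _ ≤ C / Real.sqrt (w x) * (‖a‖ * (C * ‖v‖)) := mul_le_mul_of_nonneg_left h2 (by positivity)
    _ = ‖a‖ * C ^ 2 / Real.sqrt (w x) * ‖v‖ := by ring

end Duality

/-! ## §1 One step: the LOCAL sup letter of `Q(U)` and its `L²` bound at every background of the class -/

section OneStep

variable {d : ℕ} {𝔸 : Type*} [NormedRing 𝔸] [NormOneClass 𝔸] [NormedAlgebra ℂ 𝔸] [CompleteSpace 𝔸]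
  (L : ℕ) (m : Fin d → ℕ) [∀ i, NeZero (fineP L m i)] (hL : 1 ≤ L)
  (U : Bond d (fineP L m) → 𝔸ˣ) {α : ℝ} (hα1 : α ≤ 1 / 64)
  (hU1 : ∀ (x : B7Prop1Explicit.Site d) (κ : Fin d), perCfg (fineP L m) U x κ ∈ U1 𝔸)
  (hreg : ∀ (y : TSite d m) (κ : Fin d) (r : Fin d → Fin L),
    ‖((Wcx L (perCfg (fineP L m) U) (cornerSite L y) κ (boxVec L r) : 𝔸ˣ) : 𝔸) - 1‖ ≤ α)

/-- **THE LOCAL SUP LETTER OF `Q(U)`**: `‖(Q(U)A)(c)‖ ≤ (1 + 50(d+1)α)·√(S_c(A))`, `S_c(A) = Σ_{r,i,κ′} ‖A((L·c₋ + r + iLe_κ) mod Lm, κ′)‖²` the `ℓ²` mass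
of `A` over the two blocks `B(c₋) ∪ B(c₊)` — [B7] (126) (`B7Prop3GeneralLinearBound.norm_linQcov_le`) at the box-clamped field of
`B9Eq315QLipschitzL2.exists_truncation`, by the locality (122) (`linQcov_congr`); for EVERY background with the displayed regularity letters, NO window.
[cite: Balaban1985Averaging, (126) p.36, p.24; Balaban1985BackgroundPropagators, (3.15) p.393, p.407] -/
theorem norm_QtorusLin_apply_le_local (A : Bond d (fineP L m) → 𝔸) (c : Bond d m) :
    ‖QtorusLin L m hL U hα1 hU1 hreg A c‖ ≤ (1 + 50 * (d + 1) * α) *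
      Real.sqrt (∑ r : Fin d → Fin L, ∑ i : Fin 2, ∑ κ' : Fin d,
        ‖A (perSite (fineP L m) (cornerSite L c.1 + boxVec L r + (((i : ℕ) : ℤ) * (L : ℤ)) • e c.2), κ')‖ ^ 2) := by
  obtain ⟨T, hagree, hT⟩ := exists_truncation L m hL A c
  have hLpos : (0 : ℝ) < L := by exact_mod_cast hL
  have hα0 : 0 ≤ α := (norm_nonneg _).trans (hreg c.1 c.2 fun _ => ⟨0, hL⟩); have hα8 : α ≤ 1 / 8 := hα1.trans (by norm_num)
  have hloc : linQcov L (perCfg (fineP L m) U) (perCfg (fineP L m) A) (cornerSite L c.1) c.2 =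
      linQcov L (perCfg (fineP L m) U) T (cornerSite L c.1) c.2 :=
    linQcov_congr L hL (cornerSite L c.1) c.2 (fun _ _ _ _ => rfl) hagree
  have h := norm_linQcov_le L hU1 (Real.sqrt_nonneg _) hT hL (cornerSite L c.1) c.2 hα0 hα8 (hreg c.1 c.2)
  rw [QtorusLin_apply, norm_smul, norm_inv, Complex.norm_natCast, hloc, inv_mul_le_iff₀ hLpos]
  exact h.trans (le_of_eq (by ring))

variable {W : Type*} [NormedAddCommGroup W] [InnerProductSpace ℂ W] (φ : W ≃ₗ[ℂ] 𝔸) {c₀ c₁ : ℝ} [Fact (0 < c₀)] [Fact (0 < c₁)]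
  {Mφ Mφ' : ℝ} (hMφ : 0 ≤ Mφ) (hφ : ∀ w, ‖φ w‖ ≤ Mφ * ‖w‖) (hMφ' : 0 ≤ Mφ') (hφ' : ∀ X, ‖φ.symm X‖ ≤ Mφ' * ‖X‖)

omit [NormOneClass 𝔸] [NormedAlgebra ℂ 𝔸] [CompleteSpace 𝔸] [Fact (0 < c₀)] [Fact (0 < c₁)] in
include hL hreg hMφ hMφ' in
/-- The `L²` constant of `Q(U)` is nonnegative (for `d ≥ 1` a block loop exists, so `α ≥ 0`; for `d = 0` the factor `√(2d·c₁∕c₀)` vanishes). [folklore]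
[cite: Balaban1985Averaging, (126) p.36] -/
theorem opConst_nonneg : 0 ≤ Mφ' * Mφ * (1 + 50 * (d + 1) * α) * Real.sqrt (2 * d * c₁ / c₀) := by
  rcases Nat.eq_zero_or_pos d with hd | hd
  · subst hd
    simp
  · have hm : ∀ i, m i ≠ 0 := fun i h => NeZero.ne (fineP L m i) (by change L * m i = 0; rw [h, mul_zero])
    have hα0 : 0 ≤ α :=
      (norm_nonneg _).trans (hreg (fun i => ⟨0, Nat.pos_of_ne_zero (hm i)⟩) ⟨0, hd⟩ fun _ => ⟨0, hL⟩)
    positivity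

include hMφ hφ hMφ' hφ' in
/-- **`hQ` AT EVERY BACKGROUND OF THE CLASS: `‖Q(U)f‖_{L²(c₁)} ≤ M_φ′M_φ(1 + 50(d+1)α)·√(2d·c₁∕c₀)·‖f‖_{L²(c₀)}`** — the local sup letter squared and summed
with the overlap count `Σ_c S_c ≤ 2d·Σ_b` (`B9Eq315QLipschitzL2.sum_local_mass_le`), read through `φ`, `φ⁻¹` and the two weights; NO bond window, NO
volume; `= M_φ′M_φ(1 + 50(d+1)α)√(2d·L^d)` on the one-step diagonal `c₁ = L^d c₀`.  The one-line supplier of the displayed letter `hQ : ‖Q(U)f‖ ≤ C_Q‖f‖`.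
[cite: Balaban1985BackgroundPropagators, (3.15)–(3.16) p.393, (3.82) p.407; Balaban1985Averaging, (126) p.36, p.24] -/
theorem norm_QtorusW_le [NeZero L] (f : BondL2K ℂ d (fineP L m) c₀ W) :
    ‖QtorusW L m hL φ U hα1 hU1 hreg (c₁ := c₁) f‖ ≤ Mφ' * Mφ * (1 + 50 * (d + 1) * α) * Real.sqrt (2 * d * c₁ / c₀) * ‖f‖ := by
  have hc₀ : 0 < c₀ := Fact.out; have hc₁ : 0 < c₁ := Fact.out
  have hK : 0 ≤ Mφ' * Mφ * (1 + 50 * (d + 1) * α) * Real.sqrt (2 * d * c₁ / c₀) := opConst_nonneg L m hL U hreg hMφ hMφ'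
  set C : ℝ := 1 + 50 * (d + 1) * α with hC
  set g : Bond d (fineP L m) → 𝔸 := fun b => φ (WL2.equiv ℂ (fun _ : Bond d (fineP L m) => c₀) W f b) with hg
  -- the fine side: `Σ_b ‖g b‖² ≤ M_φ²·c₀⁻¹·‖f‖²`
  have hn : ‖f‖ ^ 2 = ∑ b, c₀ * ‖WL2.equiv ℂ (fun _ : Bond d (fineP L m) => c₀) W f b‖ ^ 2 := WL2.norm_sq (𝕜 := ℂ) (w := fun _ => c₀) (V := W) f
  have hfine : ∑ b, ‖g b‖ ^ 2 ≤ Mφ ^ 2 * (c₀⁻¹ * ‖f‖ ^ 2) := by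
    rw [hn, Finset.mul_sum, Finset.mul_sum]
    refine Finset.sum_le_sum fun b _ => ?_
    have h1 : ‖g b‖ ^ 2 ≤ (Mφ * ‖WL2.equiv ℂ (fun _ : Bond d (fineP L m) => c₀) W f b‖) ^ 2 := pow_le_pow_left₀ (norm_nonneg _) (hφ _) 2
    exact h1.trans (le_of_eq (by field_simp))
  -- the coarse side, pointwise through `φ⁻¹` and the local sup letter
  have hpt : ∀ c : Bond d m, ‖WL2.equiv ℂ (fun _ : Bond d m => c₁) W (QtorusW L m hL φ U hα1 hU1 hreg (c₁ := c₁) f) c‖ ^ 2 ≤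
      Mφ' ^ 2 * (C ^ 2 * ∑ r : Fin d → Fin L, ∑ i : Fin 2, ∑ κ' : Fin d,
        ‖g (perSite (fineP L m) (cornerSite L c.1 + boxVec L r + (((i : ℕ) : ℤ) * (L : ℤ)) • e c.2), κ')‖ ^ 2) := fun c => by
    have hS0 : 0 ≤ ∑ r : Fin d → Fin L, ∑ i : Fin 2, ∑ κ' : Fin d,
        ‖g (perSite (fineP L m) (cornerSite L c.1 + boxVec L r + (((i : ℕ) : ℤ) * (L : ℤ)) • e c.2), κ')‖ ^ 2 := by positivity
    have h1 : ‖QtorusLin L m hL U hα1 hU1 hreg g c‖ ^ 2 ≤ C ^ 2 * ∑ r : Fin d → Fin L, ∑ i : Fin 2, ∑ κ' : Fin d,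
        ‖g (perSite (fineP L m) (cornerSite L c.1 + boxVec L r + (((i : ℕ) : ℤ) * (L : ℤ)) • e c.2), κ')‖ ^ 2 := by
      have h := pow_le_pow_left₀ (norm_nonneg _) (norm_QtorusLin_apply_le_local L m hL U hα1 hU1 hreg g c) 2
      rwa [mul_pow, Real.sq_sqrt hS0] at h
    rw [QtorusW_apply]
    calc _ ≤ (Mφ' * ‖QtorusLin L m hL U hα1 hU1 hreg g c‖) ^ 2 := pow_le_pow_left₀ (norm_nonneg _) (hφ' _) 2
      _ = Mφ' ^ 2 * ‖QtorusLin L m hL U hα1 hU1 hreg g c‖ ^ 2 := by ring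
      _ ≤ _ := mul_le_mul_of_nonneg_left h1 (sq_nonneg _)
  have hsq : ‖QtorusW L m hL φ U hα1 hU1 hreg (c₁ := c₁) f‖ ^ 2 ≤ (Mφ' * Mφ * C * Real.sqrt (2 * d * c₁ / c₀) * ‖f‖) ^ 2 :=
    calc ‖QtorusW L m hL φ U hα1 hU1 hreg (c₁ := c₁) f‖ ^ 2
        = ∑ c, c₁ * ‖WL2.equiv ℂ (fun _ : Bond d m => c₁) W (QtorusW L m hL φ U hα1 hU1 hreg (c₁ := c₁) f) c‖ ^ 2 :=
          WL2.norm_sq (𝕜 := ℂ) (w := fun _ : Bond d m => c₁) (V := W) _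
      _ ≤ ∑ c : Bond d m, c₁ * (Mφ' ^ 2 * (C ^ 2 * ∑ r : Fin d → Fin L, ∑ i : Fin 2, ∑ κ' : Fin d,
          ‖g (perSite (fineP L m) (cornerSite L c.1 + boxVec L r + (((i : ℕ) : ℤ) * (L : ℤ)) • e c.2), κ')‖ ^ 2)) :=
          Finset.sum_le_sum fun c _ => mul_le_mul_of_nonneg_left (hpt c) hc₁.le
      _ = c₁ * Mφ' ^ 2 * C ^ 2 * ∑ c : Bond d m, ∑ r : Fin d → Fin L, ∑ i : Fin 2, ∑ κ' : Fin d,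
          ‖g (perSite (fineP L m) (cornerSite L c.1 + boxVec L r + (((i : ℕ) : ℤ) * (L : ℤ)) • e c.2), κ')‖ ^ 2 := by
          rw [Finset.mul_sum]; exact Finset.sum_congr rfl fun c _ => by ring
      _ ≤ c₁ * Mφ' ^ 2 * C ^ 2 * (2 * d * ∑ b, ‖g b‖ ^ 2) :=
          mul_le_mul_of_nonneg_left (sum_local_mass_le L m g) (by positivity)
      _ ≤ c₁ * Mφ' ^ 2 * C ^ 2 * (2 * d * (Mφ ^ 2 * (c₀⁻¹ * ‖f‖ ^ 2))) := by gcongr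
      _ = (Mφ' * Mφ * C * Real.sqrt (2 * d * c₁ / c₀) * ‖f‖) ^ 2 := by
          rw [show (Mφ' * Mφ * C * Real.sqrt (2 * d * c₁ / c₀) * ‖f‖) ^ 2 =
              Mφ' ^ 2 * Mφ ^ 2 * C ^ 2 * (Real.sqrt (2 * d * c₁ / c₀)) ^ 2 * ‖f‖ ^ 2 by ring,
            Real.sq_sqrt (by positivity : (0 : ℝ) ≤ 2 * d * c₁ / c₀)]
          field_simp
  exact (pow_le_pow_iff_left₀ (norm_nonneg _) (mul_nonneg hK (norm_nonneg _)) two_ne_zero).1 hsq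

/-! ## §2 One step: the pointwise adjoint `Q(U)†` and the penalty letter (P₂) of `Q(U)†(a•Q(U))` -/

variable [NeZero L] [FiniteDimensional ℂ W]

include hMφ hφ hMφ' hφ' in
/-- **THE ADJOINT `Q(U)†` POINTWISE, EVERY BACKGROUND OF THE CLASS**: `‖(Q(U)†h)(b)‖ ≤ M_φ′M_φ(1 + 50(d+1)α)·√(2d·c₁∕c₀)∕√c₀·‖h‖_{L²(c₁)}` at every fine
bond — §0's duality at §1's `L²` bound. [cite: Balaban1985BackgroundPropagators, (3.15)–(3.16) p.393, (3.11) p.392; Balaban1985Averaging, (126) p.36] -/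
theorem norm_adjoint_QtorusW_apply_le (h : BondL2K ℂ d m c₁ W) (b : Bond d (fineP L m)) :
    ‖WL2.equiv ℂ (fun _ : Bond d (fineP L m) => c₀) W (LinearMap.adjoint (QtorusW L m hL φ U hα1 hU1 hreg (c₀ := c₀) (c₁ := c₁)) h) b‖ ≤
      Mφ' * Mφ * (1 + 50 * (d + 1) * α) * Real.sqrt (2 * d * c₁ / c₀) / Real.sqrt c₀ * ‖h‖ :=
  norm_adjoint_apply_le_of_norm_le (w := fun _ : Bond d (fineP L m) => c₀) _ (opConst_nonneg L m hL U hreg hMφ hMφ')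
    (norm_QtorusW_le L m hL U hα1 hU1 hreg φ hMφ hφ hMφ' hφ') h b

include hMφ hφ hMφ' hφ' in
/-- **THE PENALTY LETTER (P₂) OF THE VECTOR-FIELD AVERAGING, EVERY BACKGROUND OF THE CLASS**:
`‖((Q(U)†(a•Q(U)))v)(b)‖ ≤ |a|·(M_φ′M_φ(1 + 50(d+1)α))²·(2d·c₁∕c₀)∕√c₀·‖v‖_{L²(c₀)}` at every fine bond — LITERALLY the binder `hP₂` of the NE9 owner's
`B9Eq326LocalPartSupBound.norm_localInv_apply_le` (the value row of the local part `A₀ = Δ(U) + D_UD*_U + Q†(a•Q)` of (3.26)) at `Q := B9Eq315QTorus.QtorusW`;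
no window, no volume. [cite: Balaban1985BackgroundPropagators, (3.16) p.393, (3.26) p.395, Thm 3.3 (3.47) p.398; Balaban1985Averaging, (126) p.36] -/
theorem norm_penalty_QtorusW_apply_le (a : ℝ) (v : BondL2K ℂ d (fineP L m) c₀ W) (b : Bond d (fineP L m)) :
    ‖WL2.equiv ℂ (fun _ : Bond d (fineP L m) => c₀) W
        ((LinearMap.adjoint (QtorusW L m hL φ U hα1 hU1 hreg (c₀ := c₀) (c₁ := c₁)) ∘ₗ ((a : ℂ) • QtorusW L m hL φ U hα1 hU1 hreg (c₀ := c₀) (c₁ := c₁))) v) b‖ ≤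
      |a| * ((Mφ' * Mφ * (1 + 50 * (d + 1) * α)) ^ 2 * (2 * d * c₁ / c₀)) / Real.sqrt c₀ * ‖v‖ := by
  have hc₀ : 0 < c₀ := Fact.out; have hc₁ : 0 < c₁ := Fact.out
  have hK : 0 ≤ Mφ' * Mφ * (1 + 50 * (d + 1) * α) * Real.sqrt (2 * d * c₁ / c₀) := opConst_nonneg L m hL U hreg hMφ hMφ'
  calc ‖WL2.equiv ℂ (fun _ : Bond d (fineP L m) => c₀) W
        ((LinearMap.adjoint (QtorusW L m hL φ U hα1 hU1 hreg (c₀ := c₀) (c₁ := c₁)) ∘ₗ ((a : ℂ) • QtorusW L m hL φ U hα1 hU1 hreg (c₀ := c₀) (c₁ := c₁))) v) b‖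
      ≤ ‖(a : ℂ)‖ * (Mφ' * Mφ * (1 + 50 * (d + 1) * α) * Real.sqrt (2 * d * c₁ / c₀)) ^ 2 / Real.sqrt c₀ * ‖v‖ :=
        norm_adjoint_smul_apply_le_of_norm_le (w := fun _ : Bond d (fineP L m) => c₀) _ hK
          (norm_QtorusW_le L m hL U hα1 hU1 hreg φ hMφ hφ hMφ' hφ') (a : ℂ) v b
    _ = |a| * ((Mφ' * Mφ * (1 + 50 * (d + 1) * α)) ^ 2 * (2 * d * c₁ / c₀)) / Real.sqrt c₀ * ‖v‖ := by
        rw [Complex.norm_real, Real.norm_eq_abs, mul_pow, Real.sq_sqrt (by positivity : (0 : ℝ) ≤ 2 * d * c₁ / c₀)]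

include hMφ hφ hMφ' hφ' in
/-- **(P₂) ON THE ONE-STEP DIAGONAL `c₁ = L^d c₀`**: `p₂ = |a|·(M_φ′M_φ(1 + 50(d+1)α))²·2d·L^d∕√c₀`.
[cite: Balaban1985BackgroundPropagators, (3.16) p.393, (3.26) p.395, Thm 3.3 (3.47) p.398] -/
theorem norm_penalty_QtorusW_apply_le_diagonal (hc : c₁ = (L : ℝ) ^ d * c₀) (a : ℝ) (v : BondL2K ℂ d (fineP L m) c₀ W)
    (b : Bond d (fineP L m)) :
    ‖WL2.equiv ℂ (fun _ : Bond d (fineP L m) => c₀) W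
        ((LinearMap.adjoint (QtorusW L m hL φ U hα1 hU1 hreg (c₀ := c₀) (c₁ := c₁)) ∘ₗ ((a : ℂ) • QtorusW L m hL φ U hα1 hU1 hreg (c₀ := c₀) (c₁ := c₁))) v) b‖ ≤
      |a| * ((Mφ' * Mφ * (1 + 50 * (d + 1) * α)) ^ 2 * (2 * d * (L : ℝ) ^ d)) / Real.sqrt c₀ * ‖v‖ := by
  have hc₀ : 0 < c₀ := Fact.out
  have h1 : 2 * (d : ℝ) * c₁ / c₀ = 2 * d * (L : ℝ) ^ d := by rw [hc]; field_simp
  rw [← h1]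
  exact norm_penalty_QtorusW_apply_le L m hL U hα1 hU1 hreg φ hMφ hφ hMφ' hφ' (c₁ := c₁) a v b

/-! ## §3 One step ON THE BOND WINDOW: the sharper `L²` constant by the flat mean plus the `δ_Q`-letter -/

variable {εU : ℝ} (hεU : 0 ≤ εU) (hUε : ∀ b : Bond d (fineP L m), ‖(U b : 𝔸) - 1‖ ≤ εU)

omit [NeZero L] [FiniteDimensional ℂ W] in
include hεU hUε hMφ hφ hMφ' hφ' in
/-- **`hQ` ON THE BOND WINDOW `‖U(b) − 1‖ ≤ ε_U`**: `‖Q(U)f‖ ≤ M_φ′M_φ·(√(c₁∕(c₀L^d)) + √(2d·c₁∕c₀)·102(d+1)²L·ε_U)·‖f‖` — ne9-leaf-03's flat count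
`B9Eq315QFlatNorm.norm_QtorusW_one_le` plus ne9-leaf-02's `δ_Q`-letter `B9Eq315QLipschitzL2.norm_QtorusW_sub_flat_le_local` by the triangle inequality, the
flat background's regularity letters discharged at `α′ = 0` (`B7Eq122LinearPartIsLinear.one_mem_U1` ∕ `flat_regular`); `= M_φ′M_φ(1 + √(2d·L^d)·102(d+1)²L·ε_U)`
on the diagonal — the two lines the displayed `hQ` asks for, typed once.
[cite: Balaban1985BackgroundPropagators, (3.15)–(3.16) p.393, (3.78)–(3.79) p.406, (3.82) p.407; Balaban1985Averaging, (125)–(126) p.36] -/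
theorem norm_QtorusW_le_of_window [NeZero L] (f : BondL2K ℂ d (fineP L m) c₀ W) :
    ‖QtorusW L m hL φ U hα1 hU1 hreg (c₁ := c₁) f‖ ≤
      Mφ' * Mφ * (Real.sqrt (c₁ / (c₀ * (L : ℝ) ^ d)) + Real.sqrt (2 * d * c₁ / c₀) * (102 * (d + 1) ^ 2 * L * εU)) * ‖f‖ := by
  have hα1' : (0 : ℝ) ≤ 1 / 64 := by norm_num
  have hU1' : ∀ (x : B7Prop1Explicit.Site d) (κ : Fin d), perCfg (fineP L m) (fun _ : Bond d (fineP L m) => (1 : 𝔸ˣ)) x κ ∈ U1 𝔸 :=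
    fun x κ => one_mem_U1 x κ
  have hreg' : ∀ (y : TSite d m) (κ : Fin d) (r : Fin d → Fin L),
      ‖((Wcx L (perCfg (fineP L m) (fun _ : Bond d (fineP L m) => (1 : 𝔸ˣ))) (cornerSite L y) κ (boxVec L r) : 𝔸ˣ) : 𝔸) - 1‖ ≤ 0 :=
    fun y κ r => flat_regular (cornerSite L y) κ r
  have h1 := norm_QtorusW_one_le L m hL hα1' hU1' hreg' φ hMφ hφ hMφ' hφ' (c₁ := c₁) f
  have h2 := norm_QtorusW_sub_flat_le_local L m hL U hα1 hU1 hreg hα1' hU1' hreg' hεU hUε φ hMφ hφ hMφ' hφ' (c₁ := c₁) f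
  have h3 := norm_add_le (QtorusW L m hL φ U hα1 hU1 hreg (c₁ := c₁) f - QtorusW L m hL φ (fun _ => 1) hα1' hU1' hreg' (c₁ := c₁) f)
    (QtorusW L m hL φ (fun _ => 1) hα1' hU1' hreg' (c₁ := c₁) f)
  rw [sub_add_cancel] at h3
  nlinarith [norm_nonneg f]

include hεU hUε hMφ hφ hMφ' hφ' in
/-- **(P₂) ON THE BOND WINDOW**: `‖((Q(U)†(a•Q(U)))v)(b)‖ ≤ |a|·(M_φ′M_φ(√(c₁∕(c₀L^d)) + √(2d·c₁∕c₀)·102(d+1)²L·ε_U))²∕√c₀·‖v‖` — §0 at the window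
constant; at `ε_U = 0` on the diagonal `c₁ = L^d c₀` this is `|a|·(M_φ′M_φ)²∕√c₀`.
[cite: Balaban1985BackgroundPropagators, (3.16) p.393, (3.26) p.395, Thm 3.3 (3.47) p.398, (3.78)–(3.79) p.406] -/
theorem norm_penalty_QtorusW_apply_le_of_window (a : ℝ) (v : BondL2K ℂ d (fineP L m) c₀ W) (b : Bond d (fineP L m)) :
    ‖WL2.equiv ℂ (fun _ : Bond d (fineP L m) => c₀) W
        ((LinearMap.adjoint (QtorusW L m hL φ U hα1 hU1 hreg (c₀ := c₀) (c₁ := c₁)) ∘ₗ ((a : ℂ) • QtorusW L m hL φ U hα1 hU1 hreg (c₀ := c₀) (c₁ := c₁))) v) b‖ ≤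
      |a| * (Mφ' * Mφ * (Real.sqrt (c₁ / (c₀ * (L : ℝ) ^ d)) + Real.sqrt (2 * d * c₁ / c₀) * (102 * (d + 1) ^ 2 * L * εU))) ^ 2 /
        Real.sqrt c₀ * ‖v‖ := by
  have hK : 0 ≤ Mφ' * Mφ * (Real.sqrt (c₁ / (c₀ * (L : ℝ) ^ d)) + Real.sqrt (2 * d * c₁ / c₀) * (102 * (d + 1) ^ 2 * L * εU)) := by
    positivity
  calc ‖WL2.equiv ℂ (fun _ : Bond d (fineP L m) => c₀) W
        ((LinearMap.adjoint (QtorusW L m hL φ U hα1 hU1 hreg (c₀ := c₀) (c₁ := c₁)) ∘ₗ ((a : ℂ) • QtorusW L m hL φ U hα1 hU1 hreg (c₀ := c₀) (c₁ := c₁))) v) b‖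
      ≤ ‖(a : ℂ)‖ * (Mφ' * Mφ * (Real.sqrt (c₁ / (c₀ * (L : ℝ) ^ d)) + Real.sqrt (2 * d * c₁ / c₀) * (102 * (d + 1) ^ 2 * L * εU))) ^ 2 /
          Real.sqrt c₀ * ‖v‖ :=
        norm_adjoint_smul_apply_le_of_norm_le (w := fun _ : Bond d (fineP L m) => c₀) _ hK
          (norm_QtorusW_le_of_window L m hL U hα1 hU1 hreg φ hMφ hφ hMφ' hφ' hεU hUε (c₁ := c₁)) (a : ℂ) v b
    _ = _ := by rw [Complex.norm_real, Real.norm_eq_abs]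

end OneStep

/-! ## §4 The tower `Q_k(U)` (`k = n+1` levels) ON THE PER-LEVEL BOND WINDOWS: `hQ` and (P₂) -/

section Tower

variable {d : ℕ} {𝔸 : Type*} [NormedRing 𝔸] [NormedAlgebra ℂ 𝔸] [CompleteSpace 𝔸] [NormOneClass 𝔸]
  (L : ℕ) [NeZero L] (m : Fin d → ℕ) [∀ i, NeZero (m i)] (n : ℕ) (hL : 1 ≤ L)
  {W : Type*} [NormedAddCommGroup W] [InnerProductSpace ℂ W] (φ : W ≃ₗ[ℂ] 𝔸) {Mφ Mφ' : ℝ} (hMφ : 0 ≤ Mφ) (hMφ' : 0 ≤ Mφ')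
  (hφ : ∀ w, ‖φ w‖ ≤ Mφ * ‖w‖) (hφ' : ∀ X, ‖φ.symm X‖ ≤ Mφ' * ‖X‖) {c₀ c₁ : ℝ} [Fact (0 < c₀)] [Fact (0 < c₁)]
  (U : Bond d (towerP L m (n + 1)) → 𝔸ˣ) (α : ℕ → ℝ) (hα1 : ∀ j, α j ≤ 1 / 64)
  (hU1 : ∀ (j : ℕ) (x : B7Prop1Explicit.Site d) (κ : Fin d), perCfg (towerP L m (j + 1)) (UlevOf L m (n + 1) U j) x κ ∈ U1 𝔸)
  (hreg : ∀ (j : ℕ) (y : TSite d (towerP L m j)) (κ : Fin d) (r : Fin d → Fin L),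
    ‖((Wcx L (perCfg (towerP L m (j + 1)) (UlevOf L m (n + 1) U j)) (cornerSite L y) κ (boxVec L r) : 𝔸ˣ) : 𝔸) - 1‖ ≤ α j)
  (εU : ℕ → ℝ) (hεU : ∀ j, 0 ≤ εU j)
  (hUε : ∀ (j : ℕ) (b : Bond d (towerP L m (j + 1))), ‖(UlevOf L m (n + 1) U j b : 𝔸) - 1‖ ≤ εU j)

include hφ hφ' hMφ hMφ' hεU hUε in
/-- **`hQ` FOR THE TOWER ON THE PER-LEVEL BOND WINDOWS `‖Ū^j(b) − 1‖ ≤ ε_j`**: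
`‖Q_k(U)f‖_{L²(c₁)} ≤ M_φ′M_φ·√(c₁∕(c₀(L^k)^d))·Π_{j<k}(1 + √(L^d)·√(2d)·102(d+1)²L·ε_j)·‖f‖_{L²(c₀)}`, `k = n+1` — ne9-leaf-03's flat tower count
`B9Eq315QTowerFlatNorm.norm_QkW_one_le` plus ne9-leaf-02's `ℓ²`-telescoped `δ_{Q,k}` `B9Eq315QTowerLipschitzL2.norm_QkW_sub_flat_le_L2` by the triangle
inequality (`1 + (Π − 1) = Π`); `= M_φ′M_φ·Π_j(…)` on the diagonal `c₁ = c₀L^{kd}`, NO volume, the level count only through the product.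
[cite: Balaban1985BackgroundPropagators, (3.15)–(3.16) p.393, (3.78)–(3.79) p.406, p.407; Balaban1985Averaging, (125)–(127) pp.36–37] -/
theorem norm_QkW_le_of_window (f : BondL2K ℂ d (towerP L m (n + 1)) c₀ W) :
    ‖QkW L m n φ U hL α hα1 hU1 hreg (c₀ := c₀) (c₁ := c₁) f‖ ≤
      Mφ' * Mφ * Real.sqrt (c₁ / (c₀ * ((L : ℝ) ^ (n + 1)) ^ d)) *
        (∏ j ∈ Finset.range (n + 1), (1 + Real.sqrt ((L : ℝ) ^ d) * (Real.sqrt (2 * d) * (102 * (d + 1) ^ 2 * L * εU j)))) * ‖f‖ := by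
  have h1 := norm_QkW_one_le L m n hL φ hMφ hφ hMφ' hφ' (c₀ := c₀) (c₁ := c₁) (fun _ => 0) (fun _ => by norm_num)
    (perCfg_UlevOf_one_mem_U1 L m (n + 1)) (norm_Wcx_UlevOf_one_sub_one_le L m (n + 1) (fun _ => 0) (fun _ => le_rfl)) f
  have h2 := norm_QkW_sub_flat_le_L2 L m n hL φ hMφ hMφ' hφ hφ' U α hα1 hU1 hreg εU hεU hUε (c₀ := c₀) (c₁ := c₁) f
  have h3 := norm_add_le (QkW L m n φ U hL α hα1 hU1 hreg (c₀ := c₀) (c₁ := c₁) f -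
      QkW L m n φ (fun _ : Bond d (towerP L m (n + 1)) => (1 : 𝔸ˣ)) hL (fun _ => 0) (fun _ => by norm_num)
        (perCfg_UlevOf_one_mem_U1 L m (n + 1)) (norm_Wcx_UlevOf_one_sub_one_le L m (n + 1) (fun _ => 0) (fun _ => le_rfl)) (c₀ := c₀) (c₁ := c₁) f)
    (QkW L m n φ (fun _ : Bond d (towerP L m (n + 1)) => (1 : 𝔸ˣ)) hL (fun _ => 0) (fun _ => by norm_num)
        (perCfg_UlevOf_one_mem_U1 L m (n + 1)) (norm_Wcx_UlevOf_one_sub_one_le L m (n + 1) (fun _ => 0) (fun _ => le_rfl)) (c₀ := c₀) (c₁ := c₁) f)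
  rw [sub_add_cancel] at h3
  nlinarith [norm_nonneg f]

variable [FiniteDimensional ℂ W]

include hφ hφ' hMφ hMφ' hεU hUε in
/-- **(P₂) FOR THE TOWER ON THE PER-LEVEL BOND WINDOWS**: `‖((Q_k(U)†(a•Q_k(U)))v)(b)‖ ≤ |a|·C_k²∕√c₀·‖v‖_{L²(c₀)}` at every fine bond of the level-`k`
lattice, `C_k = M_φ′M_φ√(c₁∕(c₀(L^k)^d))·Π_{j<k}(1 + √(L^d)√(2d)·102(d+1)²L·ε_j)` — §0's duality at the tower `hQ` above: the binder `hP₂` of the owner's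
`B9Eq326LocalPartSupBound.norm_localInv_apply_le` at `Pd := towerP L m (n+1)`, `Q := B9Eq326OperatorTower.QkW`; on the diagonal `c₁ = c₀L^{kd}`, `c₀ = η^d`:
`p₂ = |a|·(M_φ′M_φ·Π_j(…))²∕√c₀` — level-free but for the profile product and duality's one-bond weight `η^{−d∕2}`.
[cite: Balaban1985BackgroundPropagators, (3.16) p.393, (3.26) p.395, Thm 3.3 p.399; Balaban1985Averaging, (125)–(127) pp.36–37] -/
theorem norm_penalty_QkW_apply_le_of_window (a : ℝ) (v : BondL2K ℂ d (towerP L m (n + 1)) c₀ W) (b : Bond d (towerP L m (n + 1))) :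
    ‖WL2.equiv ℂ (fun _ : Bond d (towerP L m (n + 1)) => c₀) W
        ((LinearMap.adjoint (QkW L m n φ U hL α hα1 hU1 hreg (c₀ := c₀) (c₁ := c₁)) ∘ₗ ((a : ℂ) • QkW L m n φ U hL α hα1 hU1 hreg (c₀ := c₀) (c₁ := c₁))) v) b‖ ≤
      |a| * (Mφ' * Mφ * Real.sqrt (c₁ / (c₀ * ((L : ℝ) ^ (n + 1)) ^ d)) *
          (∏ j ∈ Finset.range (n + 1), (1 + Real.sqrt ((L : ℝ) ^ d) * (Real.sqrt (2 * d) * (102 * (d + 1) ^ 2 * L * εU j))))) ^ 2 /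
        Real.sqrt c₀ * ‖v‖ := by
  have hK : 0 ≤ Mφ' * Mφ * Real.sqrt (c₁ / (c₀ * ((L : ℝ) ^ (n + 1)) ^ d)) *
      (∏ j ∈ Finset.range (n + 1), (1 + Real.sqrt ((L : ℝ) ^ d) * (Real.sqrt (2 * d) * (102 * (d + 1) ^ 2 * L * εU j)))) := by
    refine mul_nonneg (by positivity) (Finset.prod_nonneg fun j _ => ?_)
    have := hεU j
    positivity
  calc ‖WL2.equiv ℂ (fun _ : Bond d (towerP L m (n + 1)) => c₀) W
        ((LinearMap.adjoint (QkW L m n φ U hL α hα1 hU1 hreg (c₀ := c₀) (c₁ := c₁)) ∘ₗ ((a : ℂ) • QkW L m n φ U hL α hα1 hU1 hreg (c₀ := c₀) (c₁ := c₁))) v) b‖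
      ≤ ‖(a : ℂ)‖ * (Mφ' * Mφ * Real.sqrt (c₁ / (c₀ * ((L : ℝ) ^ (n + 1)) ^ d)) *
          (∏ j ∈ Finset.range (n + 1), (1 + Real.sqrt ((L : ℝ) ^ d) * (Real.sqrt (2 * d) * (102 * (d + 1) ^ 2 * L * εU j))))) ^ 2 /
          Real.sqrt c₀ * ‖v‖ :=
        norm_adjoint_smul_apply_le_of_norm_le (w := fun _ : Bond d (towerP L m (n + 1)) => c₀) _ hK
          (norm_QkW_le_of_window L m n hL φ hMφ hMφ' hφ hφ' U α hα1 hU1 hreg εU hεU hUε (c₀ := c₀) (c₁ := c₁)) (a : ℂ) v b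
    _ = _ := by rw [Complex.norm_real, Real.norm_eq_abs]

end Tower

end Literature.MathematicalPhysics.QuantumFieldTheory.Balaban1983to89.B9Eq316PenaltyPointwiseBound

end
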